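import Summits.SmoothPoincare4.SmoothPoincare4.Theorems.WeylBudgetCorkRegluablePscStubIsometricTransport
import Literature.Topology.FourManifolds.GluingProofs
import Literature.Geometry.Riemannian.EmbeddingPieceMetric
import Literature.Geometry.Lorentzian.Isometry
import Literature.Geometry.Lorentzian.IsometryProofs
import HarnessLib

/-!
# Stub `stub_transportSymmetricGerm` of line `birth` for crux `CorkRegluablePsc`
(item stmt-SmoothPoincare4-3206, route WeylBudget)

**Transport of a τ-symmetric PSC germ along gluing uniqueness.**  Let `P` be a closed smooth
4-manifold which is the gluing `C ∪_φ W` of two compact pieces, witnessed by explicit piece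
embeddings `jC : C → P`, `jW : W → P`, and let `P` carry a Riemannian metric `g` of positive
scalar curvature (with its Levi-Civita connection) together with an open `U ⊇ jC(∂C)` and a map
`T : P → P` which is smooth on `U`, maps `U` into `U`, is involutive on `U`, preserves the side
`jC(C)` on `U`, extends the involution `τ` of `∂C` along the seam (`T ∘ jC ∘ incl = jC ∘ incl ∘ τ`)
and is a `g`-isometry to first order on `U` (`(T^* g)_x = g_x`, `x ∈ U`).  If the standard sphere
`S⁴ ⊂ ℝ⁵` is ALSO a gluing `C ∪_φ W`, then `S⁴` carries piece embeddings and data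
`(jC', jW', g', U', T')` with the same list of properties.

Proof.  Gluing uniqueness (Hirsch, *Differential Topology* (1976), Ch. 8 §2, Thm. 2.1; the
tree's PROVED `Literature.Topology.FourManifolds.nonempty_diffeomorph_of_isBoundaryGluing_holds`)
gives a diffeomorphism `F : P ≅ S⁴`.  Push everything forward along `F`:
`jC' := F ∘ jC`, `jW' := F ∘ jW` (again a gluing witness, exactly as in the landed
`stub_isometricTransport`), `g' := (F⁻¹)^* g` (transport of a metric with its Levi-Civita
connection along a local diffeomorphism, `Literature.Geometry.Riemannian.exists_metric_comap_of_injective`: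
Riemannian, `scal g' = scal g ∘ F⁻¹ > 0`, value `g'_u(v, w) = g_{F⁻¹ u}(dF⁻¹ v, dF⁻¹ w)`; O'Neill
1983, Ch. 3, Prop. 3.59), `U' := F(U) = (F⁻¹)⁻¹' U`, `T' := F ∘ T ∘ F⁻¹`.  All clauses are
formal consequences of `F⁻¹ ∘ F = id`, `F ∘ F⁻¹ = id`; the isometry clause is the chain rule
(O'Neill 1983, Ch. 3, p. 58): at `y ∈ U'`, with `p := F⁻¹ y ∈ U`,
`((F ∘ T ∘ F⁻¹)^* (F⁻¹)^* g)_y = ((T ∘ F⁻¹)^* F^* (F⁻¹)^* g)_y = ((T ∘ F⁻¹)^* g)_y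
 = ((F⁻¹)^* T^* g)_y = ((F⁻¹)^* g)_y`, the last step because `(T^* g)_p = g_p`.

The statement is the registered stub, verbatim from the checked skeleton `Lines/birth.lean`
(namespace `Summit.SmoothPoincare4.SmoothPoincare4.Theorems`); the hypotheses
`Function.Involutive τ` and `[ContractibleSpace C]` are part of the registered signature and are
not used.  Everything is proved; no definitions, no named facts.
-/

noncomputable section

-- the prescribed namespace `Summit.<P>.<Sub>.…` duplicates `SmoothPoincare4` (P = Sub)
set_option linter.dupNamespace false

open scoped Manifold ContDiff Topology

namespace Summit.SmoothPoincare4.SmoothPoincare4.Theorems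

open Literature.Topology.FourManifolds Literature.Geometry.Lorentzian
  Literature.Geometry.Lorentzian.PseudoRiemannianMetric

section PointwiseChainRule

variable {EN : Type*} [NormedAddCommGroup EN] [NormedSpace ℝ EN] {HN : Type*} [TopologicalSpace HN]
  {IN : ModelWithCorners ℝ EN HN} {N : Type*} [TopologicalSpace N] [ChartedSpace HN N]
  {EM : Type*} [NormedAddCommGroup EM] [NormedSpace ℝ EM] {HM : Type*} [TopologicalSpace HM]
  {IM : ModelWithCorners ℝ EM HM} {M : Type*} [TopologicalSpace M] [ChartedSpace HM M]
  {EP : Type*} [NormedAddCommGroup EP] [NormedSpace ℝ EP] {HP : Type*} [TopologicalSpace HP]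
  {IP : ModelWithCorners ℝ EP HP} {Q : Type*} [TopologicalSpace Q] [ChartedSpace HP Q]

-- The next two lemmas are the pointwise companions of `pullbackBilin_comp` (`Isometry.lean`);
-- the first is the same computation as `Literature.Geometry.Lorentzian.pullbackBilin_comp_apply'`
-- (`AFEndChartPullback.lean`, not imported here to keep the import closure of this stub small).

/-- **Pointwise chain rule for pullbacks**: `((g ∘ f)^* b)_y = (f^* (g^* b))_y` as soon as `f` is
differentiable at `y` and `g` at `f y` (Mathlib `mfderiv_comp`). O'Neill 1983, Ch. 3, p. 58.
[cite: ONeill1983, Ch. 3, p. 58] -/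
theorem pullbackBilin_comp_apply_of_mdifferentiableAt {f : N → M} {g : M → Q} (y : N)
    (hg : MDifferentiableAt IM IP g (f y)) (hf : MDifferentiableAt IN IM f y)
    (b : Π z : Q, TangentSpace IP z →L[ℝ] TangentSpace IP z →L[ℝ] ℝ) :
    pullbackBilin (I := IP) (I' := IN) (g ∘ f) b y =
      pullbackBilin (I := IM) (I' := IN) f (pullbackBilin (I := IP) (I' := IM) g b) y := by
  ext v w
  simp only [pullbackBilin_apply, Function.comp_apply]
  rw [mfderiv_comp y hg hf]
  rfl

/-- The pullback `(f^* b)_y` depends on `b` only through the form `b_{f y}` at the image point.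
[folklore] -/
theorem pullbackBilin_congr_apply (f : N → M)
    {b₁ b₂ : Π x : M, TangentSpace IM x →L[ℝ] TangentSpace IM x →L[ℝ] ℝ} {y : N}
    (h : b₁ (f y) = b₂ (f y)) :
    pullbackBilin (I := IM) (I' := IN) f b₁ y = pullbackBilin (I := IM) (I' := IN) f b₂ y := by
  ext v w
  rw [pullbackBilin_apply, pullbackBilin_apply, h]

end PointwiseChainRule

section Conjugation

variable {X : Type} [TopologicalSpace X] [ChartedSpace (EuclideanSpace ℝ (Fin 4)) X]
  {X' : Type} [TopologicalSpace X'] [ChartedSpace (EuclideanSpace ℝ (Fin 4)) X']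

/-- A diffeomorphism identifies the range of `k` with the range of `F ∘ k`:
`F p ∈ range (F ∘ k) ↔ p ∈ range k` (`F` is one-to-one). [folklore] -/
theorem diffeomorph_apply_mem_range_comp_iff (F : X ≃ₘ⟮𝓡 4, 𝓡 4⟯ X') {C : Type} (k : C → X)
    (p : X) : F p ∈ Set.range (F ∘ k) ↔ p ∈ Set.range k := by
  rw [Set.range_comp]
  exact F.injective.mem_set_image

/-- **Conjugating a first-order isometry by a diffeomorphism.**  If `T` is differentiable at
`F⁻¹ y` and `(T^* b)_{F⁻¹ y} = b_{F⁻¹ y}`, then the conjugate `F ∘ T ∘ F⁻¹` preserves the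
transported family `(F⁻¹)^* b` at `y`:
`((F ∘ T ∘ F⁻¹)^* (F⁻¹)^* b)_y = ((T ∘ F⁻¹)^* F^* (F⁻¹)^* b)_y = ((T ∘ F⁻¹)^* b)_y
 = ((F⁻¹)^* T^* b)_y = ((F⁻¹)^* b)_y` (chain rule). O'Neill 1983, Ch. 3, p. 58 and pp. 90–91.
[cite: ONeill1983, Ch. 3, p. 58] -/
theorem pullbackBilin_conj_diffeomorph (F : X ≃ₘ⟮𝓡 4, 𝓡 4⟯ X')
    (b : Π x : X, TangentSpace (𝓡 4) x →L[ℝ] TangentSpace (𝓡 4) x →L[ℝ] ℝ)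
    {T : X → X} {y : X'} (hT : MDifferentiableAt (𝓡 4) (𝓡 4) T (F.symm y))
    (hiso : pullbackBilin (I := 𝓡 4) (I' := 𝓡 4) T b (F.symm y) = b (F.symm y)) :
    pullbackBilin (I := 𝓡 4) (I' := 𝓡 4) (F ∘ T ∘ F.symm)
        (pullbackBilin (I := 𝓡 4) (I' := 𝓡 4) F.symm b) y =
      pullbackBilin (I := 𝓡 4) (I' := 𝓡 4) F.symm b y := by
  have hFmd : MDifferentiable (𝓡 4) (𝓡 4) F := F.contMDiff.mdifferentiable (by simp)
  have hFsmd : MDifferentiable (𝓡 4) (𝓡 4) F.symm := F.symm.contMDiff.mdifferentiable (by simp)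
  have hTF : MDifferentiableAt (𝓡 4) (𝓡 4) (T ∘ F.symm) y := hT.comp y (hFsmd y)
  rw [pullbackBilin_comp_apply_of_mdifferentiableAt y (hFmd _) hTF,
    pullbackBilin_pullbackBilin_symm, pullbackBilin_comp_apply_of_mdifferentiableAt y hT (hFsmd y)]
  exact pullbackBilin_congr_apply F.symm hiso

end Conjugation

/-- **Stub 2T — transport of a τ-symmetric PSC germ along gluing uniqueness (M, provable now).**
If `P` is a gluing `C ∪_φ W` (explicit `jC, jW`) carrying `(g, U, T)` as in `stub_symmetricGluingOfBHData`,
and the standard `S⁴` is also a gluing `C ∪_φ W`, then `S⁴` carries piece embeddings `jC', jW'` (again a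
gluing witness for `φ`) and `(g', U', T')` with the same properties.  Proof: `F : P ≅ S⁴` by gluing
uniqueness (`Literature.Topology.FourManifolds.nonempty_diffeomorph_of_isBoundaryGluing_holds`, PROVED;
Hirsch Ch. 8 §2 Thm. 2.1); `jC' := F ∘ jC`, `jW' := F ∘ jW`, `g' := (F⁻¹)^* g`
(`PseudoRiemannianMetric.comap`, keeps Levi-Civita, Riemannian-ness and `scal`:
`Literature.Geometry.Riemannian.exists_metric_comap_of_injective` / `scalarCurvature_comap`),
`U' := F.symm ⁻¹' U`, `T' := F ∘ T ∘ F⁻¹`; all clauses by the chain rule (`pullbackBilin_conj_diffeomorph`),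
as in the landed `Summit.SmoothPoincare4.SmoothPoincare4.Theorems.stub_isometricTransport`.
[cite: HirschDT1976, Ch. 8 §2 Thm. 2.1; ONeill1983, Ch. 3 Prop. 3.59] -/
theorem stub_transportSymmetricGerm :
    ∀ (C : Type) [TopologicalSpace C] [T2Space C] [SecondCountableTopology C]
    [ChartedSpace (EuclideanHalfSpace 4) C] [IsManifold (𝓡∂ 4) ∞ C] [CompactSpace C]
    [ContractibleSpace C]
    (bC : Literature.Topology.FourManifolds.BoundaryData (𝓡∂ 4) C (𝓡 3))
    (W : Type) [TopologicalSpace W] [T2Space W] [SecondCountableTopology W]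
    [ChartedSpace (EuclideanHalfSpace 4) W] [IsManifold (𝓡∂ 4) ∞ W] [CompactSpace W]
    (bW : Literature.Topology.FourManifolds.BoundaryData (𝓡∂ 4) W (𝓡 3))
    (φ : bC.carrier ≃ₘ⟮𝓡 3, 𝓡 3⟯ bW.carrier) (τ : bC.carrier ≃ₘ⟮𝓡 3, 𝓡 3⟯ bC.carrier)
    (P : Type) [TopologicalSpace P] [T2Space P] [SecondCountableTopology P]
    [ChartedSpace (EuclideanSpace ℝ (Fin 4)) P] [IsManifold (𝓡 4) ∞ P]
    (jC : C → P) (jW : W → P)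
    (g : Literature.Geometry.Lorentzian.PseudoRiemannianMetric (𝓡 4) ∞ (EuclideanSpace ℝ (Fin 4)) (TangentSpace (𝓡 4) : P → Type _))
    (U : Set P) (T : P → P),
    Function.Involutive τ →
    Manifold.IsSmoothEmbedding (𝓡∂ 4) (𝓡 4) ∞ jC ∧ Manifold.IsSmoothEmbedding (𝓡∂ 4) (𝓡 4) ∞ jW ∧
      Set.range jC ∪ Set.range jW = Set.univ ∧
      (∀ a b, jC a = jW b ↔ ∃ z, a = bC.incl z ∧ b = bW.incl (φ z)) →
    g.IsRiemannian ∧ (∃ _ : g.HasLeviCivita, ∀ x, 0 < g.scalarCurvature x) ∧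
      IsOpen U ∧ (∀ z, jC (bC.incl z) ∈ U) ∧ ContMDiffOn (𝓡 4) (𝓡 4) ∞ T U ∧
      (∀ x ∈ U, T x ∈ U) ∧ (∀ x ∈ U, T (T x) = x) ∧
      (∀ x ∈ U, (T x ∈ Set.range jC ↔ x ∈ Set.range jC)) ∧
      (∀ z, T (jC (bC.incl z)) = jC (bC.incl (τ z))) ∧
      (∀ x ∈ U, Literature.Geometry.Lorentzian.pullbackBilin (I := 𝓡 4) (I' := 𝓡 4) T g.val x = g.val x) →
    Literature.Topology.FourManifolds.IsBoundaryGluing bC bW φ (𝓡 4) (Metric.sphere (0 : EuclideanSpace ℝ (Fin 5)) 1) →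
    ∃ (jC : C → (Metric.sphere (0 : EuclideanSpace ℝ (Fin 5)) 1)) (jW : W → (Metric.sphere (0 : EuclideanSpace ℝ (Fin 5)) 1)),
    (Manifold.IsSmoothEmbedding (𝓡∂ 4) (𝓡 4) ∞ jC ∧ Manifold.IsSmoothEmbedding (𝓡∂ 4) (𝓡 4) ∞ jW ∧
      Set.range jC ∪ Set.range jW = Set.univ ∧
      (∀ a b, jC a = jW b ↔ ∃ z, a = bC.incl z ∧ b = bW.incl (φ z))) ∧
    ∃ (g : Literature.Geometry.Lorentzian.PseudoRiemannianMetric (𝓡 4) ∞ (EuclideanSpace ℝ (Fin 4)) (TangentSpace (𝓡 4) : (Metric.sphere (0 : EuclideanSpace ℝ (Fin 5)) 1) → Type _))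
    (U : Set (Metric.sphere (0 : EuclideanSpace ℝ (Fin 5)) 1)) (T : (Metric.sphere (0 : EuclideanSpace ℝ (Fin 5)) 1) → (Metric.sphere (0 : EuclideanSpace ℝ (Fin 5)) 1)),
      g.IsRiemannian ∧ (∃ _ : g.HasLeviCivita, ∀ x, 0 < g.scalarCurvature x) ∧
      IsOpen U ∧ (∀ z, jC (bC.incl z) ∈ U) ∧ ContMDiffOn (𝓡 4) (𝓡 4) ∞ T U ∧
      (∀ x ∈ U, T x ∈ U) ∧ (∀ x ∈ U, T (T x) = x) ∧
      (∀ x ∈ U, (T x ∈ Set.range jC ↔ x ∈ Set.range jC)) ∧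
      (∀ z, T (jC (bC.incl z)) = jC (bC.incl (τ z))) ∧
      (∀ x ∈ U, Literature.Geometry.Lorentzian.pullbackBilin (I := 𝓡 4) (I' := 𝓡 4) T g.val x = g.val x) := by
  intro C _ _ _ _ _ _ _ bC W _ _ _ _ _ _ bW φ τ P _ _ _ _ _ jC jW g U T _ hwit hsym hS4
  obtain ⟨hjC, hjW, hcov, hseam⟩ := hwit
  obtain ⟨hg, ⟨hLC, hscal⟩, hU, hYU, hT, hTU, hTT, hTside, hTτ, hTiso⟩ := hsym
  -- `P` is the gluing `C ∪_φ W` too, witnessed by `jC`, `jW`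
  have hP : IsBoundaryGluing bC bW φ (𝓡 4) P := ⟨jC, jW, hjC, hjW, hcov, hseam⟩
  -- gluing uniqueness: `F : P ≅ S⁴`
  obtain ⟨F⟩ : Nonempty (P ≃ₘ⟮𝓡 4, 𝓡 4⟯ (Metric.sphere (0 : EuclideanSpace ℝ (Fin 5)) 1)) :=
    nonempty_diffeomorph_of_isBoundaryGluing_holds hP hS4
  -- the transported metric `g' := (F⁻¹)^* g`, with its Levi-Civita connection,
  -- `g'_u(v, w) = g_{F⁻¹ u}(dF⁻¹ v, dF⁻¹ w)` and `scal g' = scal g ∘ F⁻¹`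
  obtain ⟨g', hLC', hval, hR, hSc⟩ :=
    Literature.Geometry.Riemannian.exists_metric_comap_of_injective (I := 𝓡 4) (J := 𝓡 4)
      F.symm.contMDiff (injective_mfderiv_diffeomorph_symm F) g
  have hval' : g'.val = pullbackBilin (I := 𝓡 4) (I' := 𝓡 4) F.symm g.val := by
    funext u; ext v w; exact hval u v w
  refine ⟨F ∘ jC, F ∘ jW, ⟨hjC.diffeomorph_comp F, hjW.diffeomorph_comp F, ?_, ?_⟩,
    g', F.symm ⁻¹' U, F ∘ T ∘ F.symm, hR hg, ⟨hLC', fun x ↦ ?_⟩, hU.preimage F.symm.continuous,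
    ?_, ?_, ?_, ?_, ?_, ?_, ?_⟩
  · -- the pushed-forward pieces cover `S⁴` (`F` is onto)
    refine Set.eq_univ_of_forall fun y ↦ ?_
    obtain ⟨x, rfl⟩ := F.surjective y
    have hx : x ∈ Set.range jC ∪ Set.range jW := hcov ▸ Set.mem_univ x
    rcases hx with ⟨a, rfl⟩ | ⟨b, rfl⟩
    · exact Or.inl ⟨a, rfl⟩
    · exact Or.inr ⟨b, rfl⟩
  · -- and meet along the same seam (`F` is one-to-one)
    intro a b
    rw [← hseam a b]
    exact F.injective.eq_iff
  · -- positive scalar curvature: `scal g' (x) = scal g (F⁻¹ x) > 0`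
    rw [hSc x]
    exact hscal (F.symm x)
  · -- the seam lies in `U' = F(U)`
    intro z
    show F.symm (F (jC (bC.incl z))) ∈ U
    rw [F.symm_apply_apply]
    exact hYU z
  · -- `T' = F ∘ T ∘ F⁻¹` is smooth on `U'`
    exact F.contMDiff.comp_contMDiffOn (hT.comp F.symm.contMDiff.contMDiffOn fun _ h ↦ h)
  · -- `T'` maps `U'` into `U'`
    intro y hy
    show F.symm (F (T (F.symm y))) ∈ U
    rw [F.symm_apply_apply]
    exact hTU _ hy
  · -- `T'` is involutive on `U'`
    intro y hy
    show F (T (F.symm (F (T (F.symm y))))) = y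
    rw [F.symm_apply_apply, hTT _ hy, F.apply_symm_apply]
  · -- `T'` preserves the side `jC'(C) = F(jC(C))` on `U'`
    intro y hy
    show F (T (F.symm y)) ∈ Set.range (F ∘ jC) ↔ y ∈ Set.range (F ∘ jC)
    rw [diffeomorph_apply_mem_range_comp_iff, hTside _ hy,
      ← diffeomorph_apply_mem_range_comp_iff F jC (F.symm y), F.apply_symm_apply]
  · -- `T'` extends `τ` along the new seam
    intro z
    show F (T (F.symm (F (jC (bC.incl z))))) = F (jC (bC.incl (τ z)))
    rw [F.symm_apply_apply, hTτ z]
  · -- `T'` is a `g'`-isometry to first order on `U'` (chain rule)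
    intro y hy
    rw [hval']
    have hTmd : MDifferentiableAt (𝓡 4) (𝓡 4) T (F.symm y) :=
      (hT.contMDiffAt (hU.mem_nhds hy)).mdifferentiableAt (by simp)
    exact pullbackBilin_conj_diffeomorph F g.val hTmd (hTiso _ hy)

end Summit.SmoothPoincare4.SmoothPoincare4.Theorems

end
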